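import Mathlib
import Summits.ValiantsHypothesis.ValiantsHypothesis.Theses.DivisionGap

/-!
# Sketch — crux-ideate ShadowBirkhoff (stmt-ValiantsHypothesis-5069), ideator 3

First-lemma signatures of the three idea cards (they must elaborate; proofs are not required here).

* `PatternOdometerHypothesis` / `shadowBirkhoff_of_patternOdometer` — card `noncrossing-ladder-odometer`:
  the combinatorial deliverable "2^d strict unique optima inside a 0/1 pattern on poly(d) indices"
  and the glue to the crux (pattern restriction by penalties, as in the tree's
  `BirkhoffShadowLower.embed`, + `mem_extremePoints_convexHull_of_forall_lt` + padding + asymptotics).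
* `GridDimerShadow` / `shadowBirkhoff_of_gridDimerShadow` — card `planar-transport-transfer`: the
  transferred target C⁺ on the junk-free planar face (domino tilings of the 2k × 2k board) and its glue.
* `transportation_lift` — card `carstensen-flow-transfer`: transportation polytopes with integral
  margins are block-sum images of permutation matrices (the lift behind "parametric min-cost flow with
  small capacities ⇒ Birkhoff shadow").
-/

namespace Summit.ValiantsHypothesis.ValiantsHypothesis.Cruxes.ShadowBirkhoff.Ideator3

open scoped BigOperators

/-- Affine cost `∑_u (v u (ρ u)).1 + t · ∑_u (v u (ρ u)).2` of a permutation under a weight table. -/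
noncomputable def permCost {n : ℕ} (v : Fin n → Fin n → ℝ × ℝ) (ρ : Equiv.Perm (Fin n)) (t : ℝ) : ℝ :=
  (∑ u, (v u (ρ u)).1) + t * (∑ u, (v u (ρ u)).2)

/-- The combinatorial deliverable of an "odometer" construction: for some exponent `C`, on every index
set of size `n ≥ C (d+2)^C` there is a weight table `v`, a pattern `P` and `2^d` permutations inside the
pattern, each the STRICT unique minimiser of the affine cost at some parameter among all permutations
inside the pattern. (Permutations outside the pattern are disposed of by penalties in the glue.) -/
def PatternOdometerHypothesis : Prop :=
  ∃ C : ℕ, ∀ d n : ℕ, C * (d + 2) ^ C ≤ n →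
    ∃ v : Fin n → Fin n → ℝ × ℝ, ∃ P : Fin n → Fin n → Prop,
    ∃ ρs : Fin (2 ^ d) → Equiv.Perm (Fin n), ∃ ts : Fin (2 ^ d) → ℝ,
      (∀ k u, P u (ρs k u)) ∧
      ∀ k (ρ : Equiv.Perm (Fin n)), (∀ u, P u (ρ u)) → ρ ≠ ρs k →
        permCost v (ρs k) (ts k) < permCost v ρ (ts k)

/-- FIRST LEMMA (card noncrossing-ladder-odometer): the odometer deliverable implies the crux.
Proof route: penalise off-pattern permutations (tree: `BirkhoffShadowLower.embed`-style `Lmap`/`wtPen`),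
strict unique minimiser ⇒ extreme point (tree: `mem_extremePoints_convexHull_of_forall_lt`), count
(`le_ncard_of_injOn_range`), and `2^d > 2^{(log₂ n + c)^c}` for `d ≈ (n/C)^{1/C}`. -/
theorem shadowBirkhoff_of_patternOdometer :
    PatternOdometerHypothesis →
      Summit.ValiantsHypothesis.ValiantsHypothesis.Theses.DivisionGap.ShadowBirkhoff := by
  sorry

/-- Grid adjacency on the `m × m` board. -/
def GridAdj {m : ℕ} (u v : Fin m × Fin m) : Prop :=
  (u.1 = v.1 ∧ ((u.2 : ℕ) + 1 = v.2 ∨ (v.2 : ℕ) + 1 = u.2)) ∨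
  (u.2 = v.2 ∧ ((u.1 : ℕ) + 1 = v.1 ∨ (v.1 : ℕ) + 1 = u.1))

/-- Black cells of the board (chessboard colouring). -/
def IsBlack {m : ℕ} (u : Fin m × Fin m) : Prop := ((u.1 : ℕ) + (u.2 : ℕ)) % 2 = 0

open Classical in
/-- Affine cost of a board permutation, charged on black cells only (a permutation inside the adjacency
pattern is a pair of perfect matchings blacks→whites and whites→blacks; only the first is charged, so
the charged image set is exactly the set of cost pairs of domino tilings). -/
noncomputable def blackCost {m : ℕ} (w : Fin m × Fin m → Fin m × Fin m → ℝ × ℝ)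
    (ρ : Equiv.Perm (Fin m × Fin m)) (t : ℝ) : ℝ :=
  ∑ u, if IsBlack u then (w u (ρ u)).1 + t * (w u (ρ u)).2 else 0

/-- TRANSFERRED TARGET C⁺ (card planar-transport-transfer): the domino-tiling face of the Birkhoff
polytope — perfect matchings of the `2k × 2k` grid, a planar bipartite graph, hence junk-free and
isomorphic (height functions) to an alcoved polytope / parametric optimal-transport instance — already
has super-quasi-polynomial parametric complexity: more than `2^{(log₂(2k) + c)^c}` tilings are strict
unique minimisers of an affine edge cost at some parameter each. -/
def GridDimerShadow : Prop :=
  ∀ c : ℕ, ∃ k₀ : ℕ, ∀ k ≥ k₀,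
    ∃ w : Fin (2 * k) × Fin (2 * k) → Fin (2 * k) × Fin (2 * k) → ℝ × ℝ, ∃ m : ℕ,
      2 ^ ((Nat.log 2 (2 * k) + c) ^ c) < m ∧
      ∃ ρs : Fin m → Equiv.Perm (Fin (2 * k) × Fin (2 * k)), ∃ ts : Fin m → ℝ,
        (∀ i u, GridAdj u (ρs i u)) ∧
        ∀ i (ρ : Equiv.Perm (Fin (2 * k) × Fin (2 * k))), (∀ u, GridAdj u (ρ u)) →
          (∃ u, IsBlack u ∧ ρ u ≠ ρs i u) → blackCost w (ρs i) (ts i) < blackCost w ρ (ts i)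

/-- FIRST LEMMA (card planar-transport-transfer): the planar (domino) face transfers to the crux —
re-index the board by `Fin (4k²)`, penalise off-pattern permutations, pad to every `n ≥ 4k²` by identity
loops, and absorb the exponent (`log₂ n ≤ 2 log₂(2k) + 2`). -/
theorem shadowBirkhoff_of_gridDimerShadow :
    GridDimerShadow →
      Summit.ValiantsHypothesis.ValiantsHypothesis.Theses.DivisionGap.ShadowBirkhoff := by
  sorry

/-- FIRST LEMMA (card carstensen-flow-transfer): every nonnegative integer matrix with row sums `r` and
column sums `c` is the block-sum of a bijection between the split row units and the split column units
(so the transportation polytope `T(r,c)` is a linear image of the Birkhoff polytope `B_N`, `N = ∑ r`,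
and its shadows have no more vertices than shadows of `B_N`). [folklore] -/
theorem transportation_lift {p q : ℕ} (r : Fin p → ℕ) (c : Fin q → ℕ) (M : Fin p → Fin q → ℕ)
    (hr : ∀ i, ∑ j, M i j = r i) (hc : ∀ j, ∑ i, M i j = c j) :
    ∃ e : (Σ i, Fin (r i)) ≃ (Σ j, Fin (c j)),
      ∀ i j, (Finset.univ.filter (fun x : Fin (r i) => (e ⟨i, x⟩).1 = j)).card = M i j := by
  sorry

end Summit.ValiantsHypothesis.ValiantsHypothesis.Cruxes.ShadowBirkhoff.Ideator3
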